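import Summits.QuantumFields.YangMills.Theorems.BalabanUVNodesN12Prop1DirectOfClassOnly
import Literature.MathematicalPhysics.QuantumFieldTheory.Balaban1983to89.Node00.MultiScaleFibreChartB
import Literature.MathematicalPhysics.QuantumFieldTheory.Balaban1983to89.Node00.MultiScaleFibreChartCurvatureUniformB
import HarnessLib

/-!
# BalabanUVNodes ∕ N12 — (D1)‴ `(iii)_direct`, EXPLICIT-THRESHOLD FRAME, NO SMALL-BELOW LETTER: (P2c)″ (hsb-free chart half) WITH THE (P4)′ SOCKET fed by dag-n12-w6 g7's PROXIES edition — **BOND-DATUM EDITION** (`…N12Prop1DirectOfClassOnlyB`, USED DECLARATIONS ONLY)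

The print-datum ([Balaban1984PropagatorsII] (2.3)) (γ) twin of `Summits/…/Theorems/BalabanUVNodesN12Prop1DirectOfClassOnly.lean`: the declarations of the parent whose STATEMENT reads the determining datum
(`exists_curvatureLetters_family`) and which N12's junction of record v14ᴸ uses (dag-n12-c g35 probe-2 census `UsedConstsN12RoadTyped2`, THEOREMS block), re-typed over a
BOND-LEVEL datum `𝔅 : BDetSet` (F0a `B15DeterminingSetsB`) and dag-n12-c's bond-datum chart `Node00.msChartB` (✓p774329; `msChart 𝐁 = msChartB (bondsDet 𝐁)` by `rfl`).  GENERATOR twin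
(this seat's `work/g32/gen_thm.py`, block-extracted from the parent's tree bytes): namespace `…N12Prop1DirectOfClassOnlyB`, SAME short names, `DetSet ↦ BDetSet`, `AgreeOn 𝐁 ↦ AgreeOnB 𝔅`,
`IsMinimizer ↦ IsMinimizerB`, `bondsOf (𝐁 j) ↦ 𝔅 j`, `msChart ∕ constrCard ∕ constrEnum ∕ ConstrSet ↦ …B`, NODE 00 chart lemmas `…msChart… ↦ …msChartB…`; proofs VERBATIM; the parent's
datum-free declarations REUSED BY NAME (`open`), never copied (private plumbing excepted, №366 R2).  The parent's (b) statements are the instances `𝔅 := bondsDet 𝐁`.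

Cell `pub-ymgap` (HUMAN RULINGS D-0062 ∕ D-0149), seat `pub-ymgap-dag-n12-d` g32 (R134 N12 [B15] s2; the (ii) Theorems-side re-key of N12's road at print's [II] (2.3) datum — director-ym №338 ∕
№343 (E1)(iii-b), FLAG №16 ∕ ruling (α); dag-n12-c DESIGN memo a793b2ebc0b803bf (ii); `N12-ROAD-TWIN-ORDER-2026-08-30.md`).  Count-neutral helper of K1⁹ `stmt-QuantumFields-27364`,
`--kind proof --supports … --as helper`.  THEOREMS ONLY (0 `def`, 0 `instance`, 0 `sorry`).

HONEST FRAMING (director-ym №338 (5)).  PURELY ADDITIVE: the parent stays landed and true on its own text; nothing in it is edited; no displayed premise of any consumer is deleted or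
weakened; every hypothesis of the parent stays a hypothesis.  Nothing of Bałaban's analysis asserted; N12 NOT discharged; K0⁷ ∕ K1⁹ NOT closed; counts unmoved (typed 28∕28 · discharged
8∕27, A 8∕28; K 1∕4); one finite 𝕋⁴ programme at fixed ε — R4 closes the conditional rung `BalabanLadder.UV` only; NOT the Yang–Mills mass gap (Clay); nothing continuum ∕ ℝ⁴ ∕ OS.

PARENT's DOCSTRING (the mathematics and the citations; read the site-level `𝐁` as the bond datum `𝔅`):
# BalabanUVNodes ∕ N12 — (D1)‴ `(iii)_direct`, EXPLICIT-THRESHOLD FRAME, NO SMALL-BELOW LETTER: (P2c)″ (hsb-free chart half) WITH THE (P4)′ SOCKET fed by dag-n12-w6 g7's PROXIES edition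
# `N12DirectSurjHsurjProxies.exists_rightInverse_letter_of_proxies` and THE (P5) ROW fed by dag-n12-c g21's `N12ChartCurvatureOfClass.norm_fderiv_fderiv_msChart_le_of_class` — every fact about
# the minimiser read off its (2.12) class (LOCATED-HSB repaired end-to-end on the knit side)

Cell `pub-ymgap` (HUMAN RULINGS D-0062 ∕ D-0149), seat `pub-ymgap-dag-n12-d` g20 (R134 N12 [B15] s2; the lane's v9 recipe INBOX l.44121 «hsb LEAVES THE ROAD»).  Count-neutral helper of K1⁹
`stmt-QuantumFields-27364` (`--kind proof --supports … --as helper`).  THEOREMS ONLY (0 `def`, 0 `instance`, 0 `sorry`); composition BY NAME of this seat's (P2c)″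
`N12Prop1DirectOfChartHalfOfClassExplicit.…_ofWindowGaugeLetter_ofChartHalfOfClass_explicit`, dag-n12-c g21's ρ5b `N12TowerProxiesOfClass.towerProxies_Bj_of_mem_class` (p677953), §3b
`N12SiteProxiesOfClass.siteProxies_Bj_of_mem_class` (p679665) and ρ5d `N12ChartCurvatureOfClass.norm_fderiv_fderiv_msChart_le_of_class` (p679666); in §2 dag-n12-w6 g7's
`N12DirectSurjHsurjProxies.exists_rightInverse_letter_of_proxies` (p678596) and dag-n12-w4's `Node00.exists_uniform_chartCurvature_sq_bound` (p615328 lineage).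

WHY (LOCATED-HSB, lane census D4′ ∕ v2).  (D1) ∕ (D1)′ ∕ (D1)″ displayed `hsb : SmallBelow (avOfRecord F 2 Kt) (k i) U₀` for EVERY guarded minimiser — the (0.4) guard of every iterated
average at every coarse bond of the torus, also far from the support, where data are rough: unsatisfiable in the large-field regime the road is built for.  It was the premise of three
producers: the chart rows ∕ half (repaired by the lane's ρ5c — (P2c)″), the (P4)′ right inverse (repaired by dag-n12-w6's proxies edition p678596: one guarded PROXY per constrained bond and per
inner site, agreeing with `U₀` on the relevant towers), the (P5) curvature (repaired by the lane's ρ5d p679666: gauge covariance of the chart + conjugated `D²` at a near-flat core).  Here all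
three repairs are consumed: the proxies come from the class by name (ρ5b p677953 per bond, p679665 per site), the curvature bound from p679666 — so NO small-below letter is displayed.

WHAT.  (P2c)″'s statement VERBATIM except: (a) `hH` GONE; binders `(εH B M₂ ρ6 : ι → ℝ) (hB0) (hM₂0)` and letters `hHB i` (p678596's ∀-body at `(2, Kt, k i, ν.M₁, Z i; εH i, B i)`),
`hsbU i : ∀ V, ‖coeField V − 1‖ ≤ ρ6 i → SmallBelow (k i) V`, `hcurv i : ∀ 𝔹 Wd V, ‖coeField V − 1‖ ≤ ρ6 i → AgreeOn 𝔹 (M˙V) Wd → ∀ w, ‖D²Ψ_{𝔹,Wd,V}(0)(w,w)‖ ≤ M₂ i‖w‖²` and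
the floor `hερ6 : ∀ i, 6(d−1)L·εreg ≤ ρ6 i`; (b) `hM₂` GONE; (c) threshold row `δ i ≤ min (Θ i) (εH i)`; (d) the tower-box plaquette letter `hPbox` at `δ i` after `hPχ` in the frame.  Per-instance
display: (J0′) `hMin`@eR · geometry · numerics (incl. `hk1 hM4 hεreg hερ hερ6`) · chart half `C ρ Kτ ρτ ρ5`+`hhalf` · (P4)′ `εH B`+`hHB` · (P5)∕guard `ρ6 M₂`+`hsbU hcurv` · [15] Thm 1 `h15T` ·
under the threshold `hσW hPχ hPbox` (discharged downstream in (E1)).  PROOF: one term.  §2: the two displayed letter families are inhabited (`choose`).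

HONEST FRAMING ∕ LOCATED.  ∃∕∀ bookkeeping by name; all displayed letters now have by-name producers except the node-level inputs (J0′) `hMin` and `h15T` and the tolerance letters
(discharged in (E1)); per-height ∕ per-instance EXISTENCE constants (print's volume-uniform (46)∕(83) NOT claimed); nothing of Bałaban's asserted; count-neutral; N12 NOT discharged; K1⁹
NOT closed; counts unmoved; one finite 𝕋⁴ programme at fixed `ε = L^{-K}` — R4 closes only the conditional rung `BalabanLadder.UV`; no summit statement is proved here and NOT the
Yang–Mills mass gap (Clay); nothing continuum ∕ ℝ⁴ ∕ OS.

References: [Balaban1989LargeFieldI] CMP 122 (1989) 175–202, (1.74) p.192, Prop. 1 (1.77)–(1.78) p.194, (1.79) p.195; [Balaban1989LargeFieldII] CMP 122 (1989) 355–392, p.357,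
(1.7)–(1.9) p.358, (1.12)–(1.13) p.359; [Balaban1985Variational] CMP 102 (1985) 277–309, (2)–(4) p.278, Thm 1 (8) p.279, (44)–(48) p.285, (81)–(83) p.290; [Balaban1985Averaging]
CMP 98 (1985) 17–51, (19) p.21; [Balaban1988Convergent] CMP 119 (1988) 243–285, (2.2) p.255, (2.10)–(2.14) pp.256–257.
-/

noncomputable section

open Set Finset Metric Filter
open scoped BigOperators Matrix RealInnerProductSpace Real InnerProductSpace Topology Matrix.Norms.L2Operator

namespace Summit.QuantumFields.YangMills.BalabanUVNodes.N12Prop1DirectOfClassOnlyB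

open Literature.MathematicalPhysics.QuantumFieldTheory.Balaban1983to89.B15DeterminingSetsB

open Literature.MathematicalPhysics.QuantumFieldTheory.Balaban1983to89
open T4Continuum B15DeterminingSets GaugeField B16Sect1Backgrounds B15Prop1Carrier B8Eq17ClassAkV1 BlockAveraging
open B15Prop1SliceTaylorCalculus
open B15Prop1ChartCalculusSU2 (E3)
open T4CubeChartGnomonic (SU2)
open B15Prop1ChartSU2 (su2Chart)
open B15Prop1SliceCoordinates (GaugeSlice ιA freeBonds)
open B15Prop1AnalyticExtClause (cplxVec anExt)
open T4AdjointCovarianceUnitary (lieSU)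
open T4AxialGaugeSmallField (castSite boxPlaqs boxBonds)
open B6BondElimination (unitVec)
open B6TreeGaugePoincare (curl)
open B16Eq18Proof (box mem_box)
open B15Extension193 (extend)
open B15ShellGauge193 (shellGauge)
open B14.Eq213MaximalDomains (side)
open B14.Eq213DetSet B14.Eq216Concrete B15Sect1Instances B15Eq177GaugeInvariance B15Eq177ValueInvariance B15Eq177ValueInvarianceCoDiv B16Sect1Wilson
open B14.Eq22Determines (blockIter IsBlockUnion)
open Literature.MathematicalPhysics.QuantumFieldTheory.BalabanImbrieJaffe1984to88.BIJ85Eq453GaugeField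
open Node00 (expChart msChartB constrCardB)
open B15Eq112TorusCover (lift)
open B5Eq118OneStroke (iterBlockOf)
open Summit.QuantumFields.YangMills.BalabanUVNodes.N12Prop1DirectOfChartHalfOfClassExplicit (exists_domain_prop1Printed_lfVarOn_std_su2_box_intrinsic_analytic_atZSeqCoPRecord_ofThm1TorusClass_ofMinimiserFamily_ofWindowGaugeLetter_ofChartHalfOfClass_explicit)
open Summit.QuantumFields.YangMills.BalabanUVNodes.N12TowerProxiesOfClass (towerProxies_Bj_of_mem_class)
open Summit.QuantumFields.YangMills.BalabanUVNodes.N12SiteProxiesOfClass (siteProxies_Bj_of_mem_class)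
open Summit.QuantumFields.YangMills.BalabanUVNodes.N12ChartCurvatureOfClass (norm_fderiv_fderiv_msChart_le_of_class)
open Summit.QuantumFields.YangMills.BalabanUVNodes.N12DirectSurjHsurjProxies (exists_rightInverse_letter_of_proxies)
open Node00 (avOfRecord regMSCoPOfRecord coeField constrEnumB)
open B15Prop1NumericsThresholds (plaqSmallOn_of_le)

section
variable {F : T4Family}

/-- **JUNCTION (count-neutral)**: dag-n12-w4's `Node00.exists_uniform_chartCurvatureB_sq_bound (k i)` inhabits §1's letters `hsbU` ∕ `hcurv` with `ρ6 i > 0`, `M₂ i ≥ 0` per HEIGHT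
(before `ν`). [cite: Balaban1985Variational, Sect. C (44)–(48) p.285, (81)–(83) p.290; Balaban1988Convergent, (2.10)–(2.12) p.256] -/
theorem exists_curvatureLetters_family (Kt : ℕ) {ι : Type} (k : ι → ℕ) :
    ∃ ρ6 M₂ : ι → ℝ, (∀ i, 0 < ρ6 i) ∧ (∀ i, 0 ≤ M₂ i) ∧
      (∀ i (V : GaugeField (F.P Kt) 0 SU2), ‖coeField V - 1‖ ≤ ρ6 i → Node00.SmallBelow (Node00.avOfRecord F 2 Kt) (k i) V) ∧
      ∀ i (𝔅 : BDetSet (F.P Kt)) (Wd : MSField (F.P Kt) SU2) (V : GaugeField (F.P Kt) 0 SU2),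
        ‖coeField V - 1‖ ≤ ρ6 i → AgreeOnB 𝔅 (avgFamily (Node00.avOfRecord F 2 Kt) V) Wd →
        ∀ w : PBond (F.P Kt) 0 → lieSU (Fin 2), ‖fderiv ℝ (fderiv ℝ (msChartB F 2 Kt (k i) 𝔅 Wd V)) 0 w w‖ ≤ M₂ i * ‖w‖ ^ 2 := by
  choose M₂ ρ6 hM₂ hρ6 hsbU hcurv using fun i => Node00.exists_uniform_chartCurvatureB_sq_bound (F := F) (N := 2) (K := Kt) (k i)
  exact ⟨ρ6, M₂, hρ6, hM₂, hsbU, hcurv⟩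

end

end Summit.QuantumFields.YangMills.BalabanUVNodes.N12Prop1DirectOfClassOnlyB

end
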